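import Summits.AtomisticToContinuum.FouriersLaw.Theses.TransferKernelPositivity
import Summits.AtomisticToContinuum.FouriersLaw.Theorems.PuiseuxTransferLedgerContactIdentity

/-!
# `TransferKernelPositivity.ContactIdentity` (item stmt-AtomisticToContinuum-12015) — proved

The fixed-`N` "conductance = corner" calibration item of route `TransferKernelPositivity` (and a named hypothesis
of the composition of line `comonotone-local-resistance` of crux stmt-AtomisticToContinuum-9141): for
`pinnedChain ω₂ lam β γ` (all `> 0`), under weak-NESS uniqueness, along any steady-state family, at `T > 0` and
`N ≥ 2`: if `θ₀`, `θ₁` are the kinetic-temperature responses at the contact sites `0`, `N−1` and `d` the clause-(ii)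
response coefficient, then `d = γ(N−1)(1/2 − θ₀)` and `d = γ(N−1)(θ₁ + 1/2)`.

This is the verbatim content of the LANDED `PuiseuxTransferLedger.ContactIdentity` (stmt-AtomisticToContinuum-12112,
`contactIdentity_proof`: exact energy balance `J = γ(T_L − ⟨p_0²⟩) = γ(⟨p_{N−1}²⟩ − T_R)` at every `δ` in a weak
steady state with an exponential moment — supplied by uniqueness + CEHR 2018 existence — and elementary limit
algebra), which is phrased with bath sites `i, j : Fin N`, `i.val = 0`, `j.val = N − 1` and the conclusion
`γ(1/2 − a) = d/(N−1) = γ(b + 1/2)`; here: instantiate `i = ⟨0, _⟩`, `j = ⟨N−1, _⟩` and clear the denominator.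
No definitions, no named facts; standard axioms.
-/

noncomputable section

open MeasureTheory Filter Topology Set

namespace Summit.AtomisticToContinuum.FouriersLaw.Theorems

/-- **`TransferKernelPositivity.ContactIdentity` (stmt-AtomisticToContinuum-12015) holds**: under weak-NESS
uniqueness, along any steady-state family of `pinnedChain ω₂ lam β γ` (all `> 0`), for `T > 0` and `N ≥ 2`, the
contact kinetic-temperature responses `θ₀` (site `0`), `θ₁` (site `N−1`) and the response coefficient `d` satisfy
`d = γ(N−1)(1/2 − θ₀) = γ(N−1)(θ₁ + 1/2)`. Corollary of the landed `contactIdentity_proof`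
(`PuiseuxTransferLedger.ContactIdentity`, stmt-12112). [cite: BonettoLebowitzReyBellet2000, §5.2 eqs. (25)–(27)] -/
theorem transferKernelPositivity_contactIdentity_proof :
    Summit.AtomisticToContinuum.FouriersLaw.Theses.TransferKernelPositivity.ContactIdentity := by
  intro ω₂ lam β γ hω hl hβ hγ huniq μ hμ T hT N hN θ₀ θ₁ d hθ₀ hθ₁ hd
  have h := contactIdentity_proof ω₂ lam β γ hω hl hβ hγ huniq μ hμ T hT N d θ₀ θ₁
    ⟨0, by omega⟩ ⟨N - 1, by omega⟩ hN rfl rfl hd hθ₀ hθ₁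
  obtain ⟨h0, h1⟩ := h
  have hN1 : ((N : ℝ) - 1) ≠ 0 := by
    have : (2 : ℝ) ≤ N := by exact_mod_cast hN
    linarith
  constructor
  · have := h0
    field_simp at this
    linarith [this]
  · have := h1
    field_simp at this
    linarith [this]

end Summit.AtomisticToContinuum.FouriersLaw.Theorems

end
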